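import Mathlib
import HarnessLib
import Summits.NavierStokesRegularity.NavierStokesRegularity.Theorems.QuarterLogPincerColdSmoothingAssembly
import Summits.NavierStokesRegularity.NavierStokesRegularity.Theorems.QuarterLogPincerHelmholtzCentreShellKernel
import Summits.NavierStokesRegularity.NavierStokesRegularity.Theorems.QuarterLogPincerSmoothSilenceAssembly

/-!
# Route `QuarterLogPincer`, crux `TypeIQuantSubcubicExp` (stmt-NavierStokesRegularity-24077) —
# ns-idea-7's E-chain BY NAME: Sb UNCONDITIONAL; the cubic rung ⟸ {Sc′ (or Sc), B2}

With H2♭ `HelmholtzCentre.stub_shellKernelBound` in the tree (`…HelmholtzCentreShellKernel`), the vortical centre Sb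
`SilencingCost.VorticalCentre` is a theorem (`vorticalCentre_of_shellKernelBound`, `…HelmholtzCentreKernel`); together with
`…ColdSmoothingAssembly` (E1 `hotWitness_holds`, Sa♭ `regularAftermathM_holds`, CS1–CS3) and the kernels of `silencing_cost` /
`smooth_silence` / `ember_census` / `bead_census`, the E-chain reads:

* ★ `vorticalCentre_holds : SilencingCost.VorticalCentre` — Sb UNCONDITIONAL;
* `terminalEmberM_of_enstrophyPersistence : EnstrophyPersistence → TerminalEmberM` (E2♭ ⟸ Sc) and
  `terminalEmberM_of_thickBox : ThickBoxSilencingCost → TerminalEmberM` (E2♭ ⟸ Sc′);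
* `terminalEmber_of_aftermath_of_thickBox : RegularAftermath → ThickBoxSilencingCost → TerminalEmber` (E2 ⟸ Sa + Sc′) and
  `terminalEmber_of_limitStep_of_sharpAftermath : SmoothLimitStep → SharpAftermath → TerminalEmber` (E2 ⟸ L♯2 + Sa♯);
* `flarePersistence_of_enstrophyPersistence : EnstrophyPersistence → BeadCensus.FlarePersistence` (B1 ⟸ Sc);
* ★ `typeIQuantCubicExp_of_enstrophyPersistence_of_bpChainRate : EnstrophyPersistence → BPChainRate → CubicRung.TypeIQuantCubicExp` and
  ★ `typeIQuantCubicExp_of_thickBox_of_bpChainRate : LimitSilence.ThickBoxSilencingCost → BeadCensus.BPChainRate → CubicRung.TypeIQuantCubicExp`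
  — the cubic rung below the crux modulo exactly {Sc′ (or Sc), B2}.

HONEST FRAME: compositions of landed implications between Props about HYPOTHETICAL Type-I classical solutions; the load-bearing silencing
cost Sc′/Sc/Sc″ (L, Carleman-type per `Negative/SilencingCostExpSmall`) and the Barker–Prange chain rate B2 (XL) are OPEN; nothing here bears on
24077's truth, W7 or Navier–Stokes regularity (OPEN / not proved).  pub-ns-dss typer (g38), `--supports stmt-NavierStokesRegularity-24077`.
-/

noncomputable section

set_option linter.dupNamespace false

namespace Summit.NavierStokesRegularity.NavierStokesRegularity.Cruxes.TypeIQuantSubcubicExp.HelmholtzCentre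

open Summit.NavierStokesRegularity.NavierStokesRegularity.Cruxes.TypeIQuantSubcubicExp.CubicRung (TypeIQuantCubicExp)
open Summit.NavierStokesRegularity.NavierStokesRegularity.Cruxes.TypeIQuantSubcubicExp.BeadCensus (FlarePersistence BPChainRate)
open Summit.NavierStokesRegularity.NavierStokesRegularity.Cruxes.TypeIQuantSubcubicExp.EmberCensus (TerminalEmber TerminalEmberM)
open Summit.NavierStokesRegularity.NavierStokesRegularity.Cruxes.TypeIQuantSubcubicExp.SilencingCost
  (VorticalCentre EnstrophyPersistence RegularAftermath terminalEmber_of_aftermath_of_vortical_of_thickBox)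
open Summit.NavierStokesRegularity.NavierStokesRegularity.Cruxes.TypeIQuantSubcubicExp.LimitSilence (ThickBoxSilencingCost)
open Summit.NavierStokesRegularity.NavierStokesRegularity.Cruxes.TypeIQuantSubcubicExp.SmoothSilence
  (SmoothLimitStep SharpAftermath terminalEmber_of_limitStep_of_aftermath_of_vortical)
open Summit.NavierStokesRegularity.NavierStokesRegularity.Cruxes.TypeIQuantSubcubicExp.ColdSmoothing
  (terminalEmberM_of_vorticalCentre_of_enstrophyPersistence terminalEmberM_of_vorticalCentre_of_thickBox
    flarePersistence_of_vorticalCentre_of_enstrophyPersistence typeIQuantCubicExp_of_vorticalCentre_of_enstrophyPersistence_of_bpChainRate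
    typeIQuantCubicExp_of_shellKernelBound_of_thickBox_of_bpChainRate)

/-- ★ **Sb UNCONDITIONAL**: the vortical centre `SilencingCost.VorticalCentre` (H1 `stub_helmholtzNearField` and H2♭ `stub_shellKernelBound`
are tree theorems; `vorticalCentre_of_shellKernelBound`). -/
theorem vorticalCentre_holds : VorticalCentre :=
  vorticalCentre_of_shellKernelBound stub_shellKernelBound

/-- **E2♭ ⟸ Sc**: `TerminalEmberM` from enstrophy persistence alone. -/
theorem terminalEmberM_of_enstrophyPersistence (hC : EnstrophyPersistence) : TerminalEmberM :=
  terminalEmberM_of_vorticalCentre_of_enstrophyPersistence vorticalCentre_holds hC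

/-- **E2♭ ⟸ Sc′**: `TerminalEmberM` from the NS-free thick-box silencing cost alone. -/
theorem terminalEmberM_of_thickBox (hS : ThickBoxSilencingCost) : TerminalEmberM :=
  terminalEmberM_of_vorticalCentre_of_thickBox vorticalCentre_holds hS

/-- **E2 ⟸ Sa + Sc′** (the `silencing_cost` branch with Sb discharged). -/
theorem terminalEmber_of_aftermath_of_thickBox (hA : RegularAftermath) (hS : ThickBoxSilencingCost) : TerminalEmber :=
  terminalEmber_of_aftermath_of_vortical_of_thickBox hA vorticalCentre_holds hS

/-- **E2 ⟸ L♯2 + Sa♯** (the `smooth_silence` branch with Sb discharged). -/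
theorem terminalEmber_of_limitStep_of_sharpAftermath (h₂ : SmoothLimitStep) (hA : SharpAftermath) : TerminalEmber :=
  terminalEmber_of_limitStep_of_aftermath_of_vortical h₂ hA vorticalCentre_holds

/-- **B1 ⟸ Sc**: flare persistence of `bead_census` from enstrophy persistence alone. -/
theorem flarePersistence_of_enstrophyPersistence (hC : EnstrophyPersistence) : FlarePersistence :=
  flarePersistence_of_vorticalCentre_of_enstrophyPersistence vorticalCentre_holds hC

/-- ★ **The cubic rung ⟸ Sc + B2.** -/
theorem typeIQuantCubicExp_of_enstrophyPersistence_of_bpChainRate (hC : EnstrophyPersistence) (hchain : BPChainRate) :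
    TypeIQuantCubicExp :=
  typeIQuantCubicExp_of_vorticalCentre_of_enstrophyPersistence_of_bpChainRate vorticalCentre_holds hC hchain

/-- ★ **The cubic rung ⟸ Sc′ + B2**: `CubicRung.TypeIQuantCubicExp` from the thick-box silencing cost and the Bolzano–Poincaré chain
rate — every other stub of ns-idea-7's E-chain (E1a, E1b, CS1–CS3, Sa♭, H1, H2♭, Sd, Sv) is a tree theorem. -/
theorem typeIQuantCubicExp_of_thickBox_of_bpChainRate (hS : ThickBoxSilencingCost) (hchain : BPChainRate) : TypeIQuantCubicExp :=
  typeIQuantCubicExp_of_shellKernelBound_of_thickBox_of_bpChainRate stub_shellKernelBound hS hchain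

end Summit.NavierStokesRegularity.NavierStokesRegularity.Cruxes.TypeIQuantSubcubicExp.HelmholtzCentre

end
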